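import Mathlib
import Summits.AnomalousDissipation.AnomalousDissipation.Theses.DyadicWallCascade
import Summits.AnomalousDissipation.AnomalousDissipation.Theses.CoherentStates
import Summits.NavierStokesRegularity.NavierStokesRegularity.Theorems.LiouvilleConjectureNS
import Summits.AnomalousDissipation.AnomalousDissipation.Theorems.DyadicRealisation.Negative.ViscousWallProfileFalseOfLiouvilleConjectureNS
import Summits.AnomalousDissipation.AnomalousDissipation.Theorems.DyadicRealisation.Negative.DyadicRealisationLoadBearing
import Summits.AnomalousDissipation.AnomalousDissipation.Theorems.DyadicRealisation.Negative.DyadicRealisationLambVector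

/-!
# Disproof of `DyadicRealisation` — findings (crux stmt-AnomalousDissipation-17918, route DyadicWallCascade, rev 2)

Disprover work file (cdisprove seat, cycle 1, 2026-08-17).  Prose lives in docstrings; every
`theorem` below is kernel-checked unless it carries `sorry` (§5 near-misses only).

## 0. Verdict so far: NO KILL — and a checked reason why none is cheap

`DyadicRealisation` is by `rfl` the implication `ViscousWallProfile → CoherentStates.SteadyZerothLaw`
(§1).  Hence `¬DyadicRealisation ↔ ViscousWallProfile ∧ ¬SteadyZerothLaw`: a disproof must
(i) EXHIBIT the viscous wall profile — in particular a NON-CONSTANT velocity-bounded smooth entire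
steady Navier–Stokes flow on `ℝ³` (§3: a constant profile blows down to a flux-free field), i.e. a
counterexample to the steady case of the Koch–Nadirashvili–Seregin–Šverák Liouville conjecture
(§3, `LiouvilleConjectureNS_false_of_not_dyadicRealisation`, kernel-checked through the tree's
Oseen-mild bridge), none being known; and (ii) PROVE the steady negative `¬SteadyZerothLaw`
(quiet steady states for every smooth force, = CoherentStates.SteadyNeg, stmt-0222), summit-level
open.  Both halves are open problems in the "wrong" direction for a disprover.  Conversely the crux
is PROVED vacuously by any proof of the steady bounded Liouville theorem (§3,
`viscousWallProfile_false_of_liouvilleConjectureNS`) — which would sink the route at crux #3.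

## Index

* §1 Structure (rfl-level): `dyadicRealisation_iff`, `not_dyadicRealisation_iff`.
* §2 Load-bearing clauses (junk inhabitants under single-clause deletion): `F ≠ 0`, the flux
  integral and the blow-down clause are the only cheap-load-bearing clauses; deleting either flux
  clause lets the ZERO FLOW inhabit the antecedent (crux degenerates to stmt-0219); deleting the
  blow-down decouples `W` (crux degenerates to `HalfSpaceHierarchy → stmt-0219`).  Landed as
  `Theorems/DyadicRealisation/Negative/DyadicRealisationLoadBearing.lean` (p147410); re-exported here: `inhabited_without_fluxNonzero`, `inhabited_without_fluxIntegral`,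
  `without_blowdown_iff_halfSpaceHierarchy`.
* §3 What a counterexample must contain: `flux_eq_zero_of_const_blowdown` (H-free),
  `isBoundedAncientMildSolution_of_steadyClauses` (bridge into the KNSS class),
  `viscousWallProfile_false_of_liouvilleConjectureNS`, `LiouvilleConjectureNS_false_of_not_dyadicRealisation`.
  Landed as `Theorems/DyadicRealisation/Negative/ViscousWallProfileFalseOfLiouvilleConjectureNS.lean`
  (p146507).
* §3b Explicit families excluded for the hierarchy, H-free (`Negative/DyadicRealisationLambVector.lean`,
  p147413): vanishing Lamb vector `ω × V` (irrotational / Beltrami) ⇒ `F = 0`; one-signed `V₂` on the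
  unit square ⇒ `F = 0`.
* §4 Silent normalisations of the antecedent (cheap consequences, no kill): `wallSlip_of_mirror`
  (the profile's symmetry plane is a free-slip wall: `W₂ = 0` on `X₂ = 0`), `halfPeriod_at_one`
  (closed band + dilation ⇒ `V(·,·,1)` is ½-periodic: the unit square at `X₂ = 1` holds 4 minimal
  cells, `F = 4 F_cell`; harmless).
* §5 Near-misses / boundary lemmas NOT closed (sorried, paper proofs in the docstrings):
  `flux_neg_of_profile` (`F < 0`: inflow profiles only — the variant of the antecedent with
  `0 < F` is EMPTY) and `zeroStress_of_profile` (`⟨V₂V_h⟩ = 0`).  Both coincide with the picked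
  line's stubs `stub_fluxSign` / `stub_zeroStress` (PICKED.md); the box-average proofs recorded
  here need NO gradient bound on `W` (sliding averages absorb the viscous boundary terms).
* §6 Targets (the lead's stubs): none registered yet (skeleton of line `Sketch` =
  `Cruxes/DyadicRealisation/SketchIdeator1.lean` not yet cut into `stub_*`).  Pre-attack notes on
  the typed pieces are in the docstring of §6.
* §7 Literature / barriers consulted (docstring of §7).

## Attacks tried (cycle 1) → outcome
* junk inhabitants of the full antecedent: constants `W ≡ c` (killed by `F ≠ 0`, §3); shear /
  unidirectional / 2.5-D / Beltrami / potential entire flows (bounded ones are constant — paper);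
  linear strain flows (unbounded; blow-down diverges) — none survives: the antecedent has NO junk
  model, its inhabitation is crux #2 + a Liouville counterexample.
* Lean-encoding junk: `fderiv`/`gradient`/Bochner-integral junk values are all excluded by the
  `C^∞` clauses on `W, P` (entire) and `V, Q` (open half-space, which contains the plane `X₂ = 1`
  of the flux integrals, so the integrands are continuous and bounded on the compact square);
  `!₂[q.1, q.2, 1]`, `EuclideanSpace.single`, component `2` = vertical: all as intended.
* flux identities against the aperiodic profile (energy, horizontal/vertical momentum, mass, head
  maximum principle): give `F < 0`, `τ = 0`, `⟨V₂² + Q⟩` free, dissipation per unit wall area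
  `2|F|` saturating the generic bound `∫_{B_R}|∇W|² ≤ K R²` for bounded steady flows — CONSISTENT,
  no contradiction (§5); the rev-1 periodic kill (analytic rigidity) does not bite rev 2.
* Liouville literature for the exact class (bounded, mirror-symmetric ⇒ free-slip half-space,
  pressure bounded, self-similar periodic asymptotics): nothing covers it (§7).
* natural strengthenings: "conclusion for EVERY smooth force" is false at `f = 0`
  (`ν‖∇u‖² = ⟨f,u⟩ = 0`) but is not what the crux says; 2-D analogue empty (crux #2 is provably
  empty in 2-D, planner NOTES L3; and steady 2-D is quiet, Alexakis–Doering barrier) — not the crux.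
-/

open scoped BigOperators Topology
open Filter Set MeasureTheory Function

-- the mandated namespace repeats `AnomalousDissipation` (single-problem summit)
set_option linter.dupNamespace false

namespace Summit.AnomalousDissipation.AnomalousDissipation.Cruxes.DyadicRealisation.Disproof

open Summit.AnomalousDissipation.AnomalousDissipation.Theses
open Literature.Analysis.FluidPDE Literature.Uncategorized

local notation "E³" => EuclideanSpace ℝ (Fin 3)

/-! ## §1 Structure -/

/-- The crux is, definitionally, `ViscousWallProfile → SteadyZerothLaw` (stmt-17919 → stmt-0219). -/
theorem dyadicRealisation_iff :
    DyadicWallCascade.DyadicRealisation ↔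
      (DyadicWallCascade.ViscousWallProfile → CoherentStates.SteadyZerothLaw) :=
  Iff.rfl

/-- What a disproof IS: the profile exists AND the steady zeroth law fails for every force. -/
theorem not_dyadicRealisation_iff :
    ¬ DyadicWallCascade.DyadicRealisation ↔
      (DyadicWallCascade.ViscousWallProfile ∧ ¬ CoherentStates.SteadyZerothLaw) :=
  Classical.not_imp

/-- Under the steady negative (`¬SteadyZerothLaw`, the conclusion of CoherentStates.SteadyNeg /
Neg route, stmt-0222) the crux is EQUIVALENT to the non-existence of the profile: cruxes #3 (build
the profile) and #4 (this crux) then pull in opposite directions — the route is consistent only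
in the world where stmt-0219 holds, as it must be. -/
theorem dyadicRealisation_iff_not_viscousWallProfile_of_not_steadyZerothLaw
    (hneg : ¬ CoherentStates.SteadyZerothLaw) :
    DyadicWallCascade.DyadicRealisation ↔ ¬ DyadicWallCascade.ViscousWallProfile :=
  ⟨fun hD hA => hneg (hD hA), fun h hA => absurd hA h⟩

/-- The vacuous direction: if the profile does not exist the crux holds (and the route is dead at
crux #3, whose conclusion is the profile block). -/
theorem dyadicRealisation_of_not_viscousWallProfile (h : ¬ DyadicWallCascade.ViscousWallProfile) :
    DyadicWallCascade.DyadicRealisation :=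
  fun hA => absurd hA h

/-! ## §2 Load-bearing clauses — LANDED as
`Theorems/DyadicRealisation/Negative/DyadicRealisationLoadBearing.lean` (namespace
`…Theorems.DyadicWallCascadeNegative`): `inhabited_without_fluxNonzero`, `inhabited_without_fluxIntegral`,
`without_blowdown_iff_hierarchy`, `imp_iff_of_without_{fluxNonzero,fluxIntegral,blowdown}`,
`without_{fluxNonzero,fluxIntegral}_iff_steadyZerothLaw`, `without_blowdown_iff_hierarchy_imp_steadyZerothLaw`,
`not_steadyZerothLaw_of_not_dyadicRealisation`; plus the silent normalisations `wallSlip_of_mirror`,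
`halfPeriod_at_one` (§4).  Every OTHER single deletion leaves crux #2 or a Liouville counterexample
inside the block (module docstring there): no junk inhabitant, no emptiness proof.  Re-exported: -/

export Summit.AnomalousDissipation.AnomalousDissipation.Theorems.DyadicWallCascadeNegative
  (inhabited_without_fluxNonzero inhabited_without_fluxIntegral without_blowdown_iff_hierarchy
   without_fluxNonzero_iff_steadyZerothLaw without_fluxIntegral_iff_steadyZerothLaw
   without_blowdown_iff_hierarchy_imp_steadyZerothLaw not_steadyZerothLaw_of_not_dyadicRealisation
   wallSlip_of_mirror halfPeriod_at_one
   isBoundedAncientMildSolution_of_steadyClauses const_of_liouvilleConjectureNS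
   flux_eq_zero_of_const_blowdown
   bernoulli_const_of_lamb_zero flux_eq_zero_of_lamb_zero not_hierarchyBlock_of_lamb_zero
   not_profileBlock_of_lamb_zero exists_lamb_ne_zero_of_viscousWallProfile
   flux_eq_zero_of_vertical_sign exists_downdraft_and_updraft_of_viscousWallProfile)

/-! ## §3 What a counterexample must contain — LANDED as
`Theorems/DyadicRealisation/Negative/ViscousWallProfileFalseOfLiouvilleConjectureNS.lean` (p146507):
bridge `isBoundedAncientMildSolution_of_steadyClauses` (velocity-bounded smooth entire steady NS ⇒
KNSS class), `const_of_liouvilleConjectureNS`, `flux_eq_zero_of_const_blowdown` (H-free: constant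
profiles blow down flux-free), `ViscousWallProfile_false_of_LiouvilleConjectureNS`,
`LiouvilleConjectureNS_false_of_not_DyadicRealisation`.  Pointers: -/

/-- (landed, p146507) modulo the KNSS Liouville conjecture the antecedent is empty. -/
theorem viscousWallProfile_false_of_liouvilleConjectureNS
    (hL : Summit.NavierStokesRegularity.NavierStokesRegularity.LiouvilleConjectureNS) :
    ¬ DyadicWallCascade.ViscousWallProfile :=
  Summit.AnomalousDissipation.AnomalousDissipation.Theorems.ViscousWallProfile_false_of_LiouvilleConjectureNS hL

/-- (landed, p146507) any disproof of the crux refutes the KNSS Liouville conjecture. -/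
theorem liouvilleConjectureNS_false_of_not_dyadicRealisation
    (hD : ¬ DyadicWallCascade.DyadicRealisation) :
    ¬ Summit.NavierStokesRegularity.NavierStokesRegularity.LiouvilleConjectureNS :=
  Summit.AnomalousDissipation.AnomalousDissipation.Theorems.LiouvilleConjectureNS_false_of_not_DyadicRealisation hD

/-- (vacuity, modulo (L)) the crux HOLDS if the KNSS Liouville conjecture does — the route then
dies at crux #3 (`ViscousContinuation` collapses to `¬HalfSpaceHierarchy`). -/
theorem dyadicRealisation_of_liouvilleConjectureNS
    (hL : Summit.NavierStokesRegularity.NavierStokesRegularity.LiouvilleConjectureNS) :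
    DyadicWallCascade.DyadicRealisation :=
  dyadicRealisation_of_not_viscousWallProfile (viscousWallProfile_false_of_liouvilleConjectureNS hL)

/-! ## §3b Explicit families excluded for the hierarchy (H-free): vanishing Lamb vector
File `Theorems/DyadicRealisation/Negative/DyadicRealisationLambVector.lean` (p147413):
`bernoulli_const_of_lamb_zero` (Euler clause + `ω × V = 0` on the half-space ⇒ Bernoulli function
constant, via `Convex.is_const_of_fderivWithin_eq_zero`), `flux_eq_zero_of_lamb_zero` (then
`F = const × mass flux = 0`), `not_hierarchyBlock_of_lamb_zero`, `not_profileBlock_of_lamb_zero`,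
`exists_lamb_ne_zero_of_viscousWallProfile`: potential flows `V = ∇φ` (`φ` harmonic,
`1`-homogeneous — the natural dilation-invariant candidates) and (generalised) Beltrami flows are
NOT hierarchies; the blow-down of any profile has `ω × V ≠ 0` somewhere. -/

/-! ## §4 Silent normalisations — LANDED with §2 (`wallSlip_of_mirror`, `halfPeriod_at_one`). -/

/-! ## §5 Near-misses: boundary lemmas on paper, NOT closed in Lean

Both statements below are consequences of the antecedent established on paper by three refuter
seats (rattack-17918, rattack-18630-g2, this one) and adopted by the lead as the stubs
`stub_fluxSign` and `stub_zeroStress` of the picked line.  They are recorded here as the EMPTINESS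
of two natural variants of the antecedent (outflow profiles; sheared profiles).  Obstruction to
closing them now: the divergence theorem on boxes of `EuclideanSpace ℝ (Fin 3)`
(`MeasureTheory.integral_divergence_of_hasFDerivWithinAt_off_countable_of_equiv`) with face
bookkeeping, the pointwise local energy / momentum identities from the `fderiv` clauses, and two
limits (`L → ∞`, then `m → ∞`) — est. 1.5–2 k lines; the tree's localised steady energy identity
`IsLerayProfile.integral_mul_frobeniusNormSq_eq` (FluidPDE/SteadyNSLocalEnergy.lean) is the
natural starting point (the lead's plan).  Whoever lands the stubs closes these. -/

/-- **Inflow only (`F < 0`): the outflow variant of the antecedent is empty** — paper proof, not yet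
kernel-checked.  Box energy identity for the smooth flow `W` (ν = 1): with `e = |W|²/2`,
`H = e + P`, `|∇W|² = Δe − div(HW)` pointwise, so for `Ω = [a,a+L]² × [0,Z]`
`∫_Ω |∇W|² = ∮_∂Ω (∂ₙe − H W·n)`.  Bottom face: `W₂ = 0` and `∂_z e = W_h·∂_zW_h = 0` by mirror
symmetry (`wallSlip_of_mirror`; `W_h` even) — contributes `0`.  SLIDING AVERAGES over
`a ∈ [a₀, a₀+1]` (both horizontal offsets) and over `Z ∈ [2^m, 2^{m+1}]` turn every `∂ₙe`
boundary term into a difference of values of `e ≤ C'²/2` — lateral `O(C'² L Z)`, top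
`O(C'² L² / 2^m)` — so NO gradient bound on `W` is needed; the advective lateral term is
`O(K L Z)`, `K = C'(C'²/2 + C')`.  Top advective term: by the blow-down clause (W and P parts,
uniform on the band) and the energy conservation of the Euler hierarchy `V` on its period cells
(flux `F` per unit cell at every height of the band — Euler + periodicity + divergence clause),
`−∫_top H W₂ = −4^m (L'² F + O(L') + O(ε L'²))`, `L = 2^m L'`.  Dividing by `4^m L'²` and letting
`L' → ∞`, `m → ∞`: `0 ≤ (dissipation per unit wall area below height 2^{m+1}) = −F + o(1)`, hence
`F ≤ 0`, and `F ≠ 0` gives `F < 0`; equivalently the block with `0 < F` is uninhabited. -/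
theorem not_profile_of_flux_pos :
    ¬ ∃ (W : EuclideanSpace ℝ (Fin 3) → EuclideanSpace ℝ (Fin 3)) (P : EuclideanSpace ℝ (Fin 3) →
    ℝ) (V : EuclideanSpace ℝ (Fin 3) → EuclideanSpace ℝ (Fin 3)) (Q : EuclideanSpace ℝ (Fin 3) → ℝ)
    (C F C' : ℝ),
      let H : Set (EuclideanSpace ℝ (Fin 3)) := {X | 0 < X 2};
      let e : Fin 3 → EuclideanSpace ℝ (Fin 3) := fun i => EuclideanSpace.single i (1 : ℝ);
      let pt : ℝ × ℝ → EuclideanSpace ℝ (Fin 3) := fun q => !₂[q.1, q.2, (1 : ℝ)];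
      let σ : EuclideanSpace ℝ (Fin 3) → EuclideanSpace ℝ (Fin 3) := fun X => X - (2 * X 2) • e 2;
      (ContDiffOn ℝ ((⊤ : ℕ∞) : WithTop ℕ∞) V H ∧ ContDiffOn ℝ ((⊤ : ℕ∞) : WithTop ℕ∞) Q H ∧ (∀ X ∈
      H, ‖V X‖ ≤ C ∧ |Q X| ≤ C) ∧ (∀ X ∈ H, ∑ i : Fin 3, (fderiv ℝ V X (e i)) i = 0) ∧ (∀ X ∈ H,
      (fderiv ℝ V X) (V X) + gradient Q X = 0) ∧ (∀ X ∈ H, V ((2 : ℝ) • X) = V X ∧ Q ((2 : ℝ) • X)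
      = Q X) ∧ (∀ X : EuclideanSpace ℝ (Fin 3), 1 ≤ X 2 → X 2 ≤ 2 → V (X + e 0) = V X ∧ V (X + e 1)
      = V X ∧ Q (X + e 0) = Q X ∧ Q (X + e 1) = Q X) ∧ (∫ q in Set.Icc (0 : ℝ) 1 ×ˢ Set.Icc (0 : ℝ)
      1, (V (pt q)) 2 = 0) ∧ 0 < F ∧ (∫ q in Set.Icc (0 : ℝ) 1 ×ˢ Set.Icc (0 : ℝ) 1, (V (pt q)) 2 *
      (‖V (pt q)‖ ^ 2 / 2 + Q (pt q)) = F)) ∧ ContDiff ℝ ((⊤ : ℕ∞) : WithTop ℕ∞) W ∧ ContDiff ℝ ((⊤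
      : ℕ∞) : WithTop ℕ∞) P ∧ (∀ X, ‖W X‖ ≤ C' ∧ |P X| ≤ C') ∧ (∀ X, W (σ X) = σ (W X) ∧ P (σ X) =
      P X) ∧ (∀ X, ∑ i : Fin 3, (fderiv ℝ W X (e i)) i = 0) ∧ (∀ X, (fderiv ℝ W X) (W X) + gradient
      P X = ∑ i : Fin 3, fderiv ℝ (fun Y => fderiv ℝ W Y (e i)) X (e i)) ∧ (∀ ε : ℝ, 0 < ε → ∃ M :
      ℕ, ∀ m : ℕ, M ≤ m → ∀ X : EuclideanSpace ℝ (Fin 3), 1 ≤ X 2 → X 2 ≤ 2 → ‖W ((2 : ℝ) ^ m • X)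
      - V X‖ ≤ ε ∧ |P ((2 : ℝ) ^ m • X) - Q X| ≤ ε) := by
  sorry

/-- **Zero Reynolds stress of the blow-down (`τ = ⟨V₂V_h⟩ = 0`): the sheared variant is empty** —
paper proof, not yet kernel-checked.  Horizontal momentum `div(W W_h + P e_h − ∇W_h) = 0` on the
same boxes `[a,a+L]² × [0,Z]`: the bottom face is flux-free (`W₂ = 0`, `∂_zW_h = 0` by evenness),
sliding averages make the viscous face terms differences of the bounded `W_h` (lateral
`O(C' L Z)`, top `O(C' L²/2^m)`), the advective + pressure lateral term is `O((C'² + C') L Z)`, and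
the top advective term is `4^m (L'² τ_h + O(L') + O(ε L'²))` by the blow-down clause and the
constancy of `⟨V₂V_h⟩` across the band (Euler + periodicity).  Dividing by `4^m L'²`:
`τ_h = O(C'²/L') + O(C'/2^m) + O(ε) → 0`.  (At `X₂ = 1` the unit square is 4 minimal cells,
`halfPeriod_at_one`, so the unit-square integrals vanish too.) -/
theorem not_profile_of_stress_ne_zero :
    ¬ ∃ (W : EuclideanSpace ℝ (Fin 3) → EuclideanSpace ℝ (Fin 3)) (P : EuclideanSpace ℝ (Fin 3) →
    ℝ) (V : EuclideanSpace ℝ (Fin 3) → EuclideanSpace ℝ (Fin 3)) (Q : EuclideanSpace ℝ (Fin 3) → ℝ)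
    (C F C' : ℝ),
      let H : Set (EuclideanSpace ℝ (Fin 3)) := {X | 0 < X 2};
      let e : Fin 3 → EuclideanSpace ℝ (Fin 3) := fun i => EuclideanSpace.single i (1 : ℝ);
      let pt : ℝ × ℝ → EuclideanSpace ℝ (Fin 3) := fun q => !₂[q.1, q.2, (1 : ℝ)];
      let σ : EuclideanSpace ℝ (Fin 3) → EuclideanSpace ℝ (Fin 3) := fun X => X - (2 * X 2) • e 2;
      (ContDiffOn ℝ ((⊤ : ℕ∞) : WithTop ℕ∞) V H ∧ ContDiffOn ℝ ((⊤ : ℕ∞) : WithTop ℕ∞) Q H ∧ (∀ X ∈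
      H, ‖V X‖ ≤ C ∧ |Q X| ≤ C) ∧ (∀ X ∈ H, ∑ i : Fin 3, (fderiv ℝ V X (e i)) i = 0) ∧ (∀ X ∈ H,
      (fderiv ℝ V X) (V X) + gradient Q X = 0) ∧ (∀ X ∈ H, V ((2 : ℝ) • X) = V X ∧ Q ((2 : ℝ) • X)
      = Q X) ∧ (∀ X : EuclideanSpace ℝ (Fin 3), 1 ≤ X 2 → X 2 ≤ 2 → V (X + e 0) = V X ∧ V (X + e 1)
      = V X ∧ Q (X + e 0) = Q X ∧ Q (X + e 1) = Q X) ∧ (∫ q in Set.Icc (0 : ℝ) 1 ×ˢ Set.Icc (0 : ℝ)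
      1, (V (pt q)) 2 = 0) ∧ F ≠ 0 ∧ (∫ q in Set.Icc (0 : ℝ) 1 ×ˢ Set.Icc (0 : ℝ) 1, (V (pt q)) 2 *
      (‖V (pt q)‖ ^ 2 / 2 + Q (pt q)) = F)) ∧ ContDiff ℝ ((⊤ : ℕ∞) : WithTop ℕ∞) W ∧ ContDiff ℝ ((⊤
      : ℕ∞) : WithTop ℕ∞) P ∧ (∀ X, ‖W X‖ ≤ C' ∧ |P X| ≤ C') ∧ (∀ X, W (σ X) = σ (W X) ∧ P (σ X) =
      P X) ∧ (∀ X, ∑ i : Fin 3, (fderiv ℝ W X (e i)) i = 0) ∧ (∀ X, (fderiv ℝ W X) (W X) + gradient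
      P X = ∑ i : Fin 3, fderiv ℝ (fun Y => fderiv ℝ W Y (e i)) X (e i)) ∧ (∀ ε : ℝ, 0 < ε → ∃ M :
      ℕ, ∀ m : ℕ, M ≤ m → ∀ X : EuclideanSpace ℝ (Fin 3), 1 ≤ X 2 → X 2 ≤ 2 → ‖W ((2 : ℝ) ^ m • X)
      - V X‖ ≤ ε ∧ |P ((2 : ℝ) ^ m • X) - Q X| ≤ ε) ∧ ((∫ q in Set.Icc (0 : ℝ) 1 ×ˢ Set.Icc (0 : ℝ)
      1, (V (pt q)) 2 * (V (pt q)) 0 ≠ 0) ∨ (∫ q in Set.Icc (0 : ℝ) 1 ×ˢ Set.Icc (0 : ℝ) 1, (V (pt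
      q)) 2 * (V (pt q)) 1 ≠ 0)) := by
  sorry

/-! ## §6 Targets — the lead's skeleton `Cruxes/DyadicRealisation/Lines/Sketch.lean` (06:56Z; stubs not
yet in this seat's payload, read from the tree): `stub_gateReduction`, `stub_fluxSign`,
`stub_zeroStress`, `stub_lerayCapping`, `stub_testedRealisation`, composed BY NAME into the crux
(`dyadicRealisation_of`).  Pre-attack, stub by stub:

* `stub_gateReduction` — TRUE (steady energy identity `ν‖∇u‖² = ∫⟪f,u⟫`, then the Leray relation
  tested with `w := u_j`, smooth and solenoidal).  `r` is not assumed smooth or integrable: harmless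
  (a junk `∫⟪r,u_j⟫ = 0` only makes the floor hypothesis `ε ≤ 0` unsatisfiable).  No attack.
* `stub_fluxSign` — TRUE on paper (§5; sign re-derived independently here: `0 ≤ ∫|∇W|² =
  −(F per unit area)·(area) + o`, so `F ≤ 0`).  No attack.
* `stub_zeroStress` — TRUE on paper (§5).  No attack.
* `stub_lerayCapping` — construction; internal consistency of the twelve output clauses checked by
  hand: (6) needs `V` 1-periodic below height `1/16` — provable from dilation + band periodicity
  (`2^k`-fold iteration); (6)/(7) vs the `Y₂`-periodicity of `Torus.lift ub` — compatible (collar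
  pieces `(0,1/16)` and `(15/16,1)`); (8) smooth up to `Y₂ → 1⁻` via the mirror piece; (11) on the
  collar forces `lift f = ∇(π − Q)`, consistent with `f = r − ∇φ`, `r = 0` there; zero mean of `r`
  needs `∫ r_h = −2τ_h = 0` (the `τ = 0` hypotheses — present) and `∫ r₂ = 0` (automatic by mirror
  symmetry of `ū₂² + χQ̃` at the two collar ends); (12) `∫⟪r,ū⟫ = ∫⟪f,ū⟫ + ∫⟪∇φ,ū⟫ = −2F + 0`
  (energy flux `F` per unit cross-section at every collar height by dilation + periodicity; the
  gradient term vanishes because `V₂(·,δ) ⇀ 0` as `δ → 0`).  No inconsistency found; plausible TRUE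
  (Bogovskiĭ corrector on `T² × [1/16, 1/8]` with zero-mean data).  No attack.
* `stub_testedRealisation` (C⁺) — quantifies over `IsHalfSpaceHierarchy`-data (no junk inhabitant,
  no known inhabitant) and over ALL capped tuples; a refutation modulo a hierarchy would need ONE
  capped force `f` whose steady states are provably quiet or energy-unbounded at small `ν`: `f = 0`
  is excluded (`∫⟪r,ū⟫ = −2F ≠ 0` with `r` a gradient vanishing on the collar), laminar
  Stokes-eigenforces cannot arise (on the collar `f` is a harmonic gradient), and for every other
  smooth force loudness of steady states is open both ways.  Honest strength: SteadyWeakRealisation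
  (stmt-1303) for one explicit force.  No attack possible now; the disprover's standing offer to
  the lead is §5 (box-average proofs of the two sign stubs without gradient bounds).

Fallback lines (SketchIdeator2, lead's order baire-soft-closing > solenoid-limit-periodic-cap >
time-of-flight-weights), pre-attack on the typed first lemmas in case the lead switches:
* `WeightedTransportCoercivity` (card time-of-flight-weights) AS TYPED is junk-refutable,
  unconditionally: `κ` is unrestricted and `σ` is an arbitrary function (no measurability, no local
  integrability).  Witness: `Ω = univ`, `κ = 0`, `φ ≡ 1` (so `ū·∇φ = 0 ≤ −κσφ = 0`),
  `ū X = (X₀, −X₁, 0)` (smooth, solenoidal, `|⟪Dū w, w⟫| ≤ |w|²`), `σ X = 1 + ‖X − X⋆‖⁻³`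
  (`≥ ‖Dū‖`, NOT locally integrable at `X⋆`), `v = ψ e₁` a bump with `ψ(X⋆) ≠ 0`: the left side
  `(κ/2 − 1) ∫ φσ|v|² = −(Bochner junk 0) = 0`, the right side `∫⟪Dū v, v⟫ = −∫ψ² < 0`.  Repair:
  add `2 < κ` (then the weight hypothesis bounds `σ ≤ −ū·∇φ/(κφ)` locally, and non-measurable `σ`
  only makes the left side `0 ≤` a non-negative right side) and/or `Measurable σ` +
  `LocallyIntegrable σ`.  (misstated, not substantive; recorded for the planner, no Lean spent.)
* `BaireReduction := RobustApproxLoudSteady → SteadyZerothLaw`: refutable only through `¬SteadyZerothLaw`;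
  `RobustApproxLoudSteady` has no junk inhabitant (all fields smooth ⇒ `iteratedFDeriv` genuine;
  high-frequency Beltrami trial states have `C^k` residual `νN² N^k √E`, not small) and is not
  obviously false — a genuine approximate-and-robust form of stmt-0219.
* `PeriodisedInnerApproximants` (solenoid card): construction claim, plausible; but its companion
  transfer `ViscousWallProfile → HasDyadicAlmostPeriodsOnSlabs W` is NOT implied by bare existence
  of the profile (the ideator says so itself) — a line built on it restates the antecedent.
-/

/-! ## §7 Literature and barriers consulted (cycle 1)

* KNSS, Acta Math. 203 (2009) = arXiv:0709.3599: conjecture (L) (tree: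
  `LiouvilleConjectureNS`), Thm 5.1 (2-D), Thm 5.2 (axisymmetric, no swirl) — neither covers a
  mirror-symmetric 3-D profile.
* Bang–Gui–Wang–Xie, arXiv:2205.13259 (JFM), abstract read: slab `ℝ² × [0,1]`; no-slip ⇒ bounded
  solutions trivial if axisymmetric or `r u^r` bounded, Poiseuille if `‖u‖_∞` small; PERIODIC slab
  ⇒ bounded solutions constant only under θ-independence of swirl/radial velocity or `r u^r → 0`.
  Key tool: Saint-Venant growth estimate of the Dirichlet integral — our profile SATURATES the
  generic growth `∫_{B_R}|∇W|² ~ R²` (dissipation `2|F|` per unit wall area), so Saint-Venant-type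
  arguments have no room.
* Han–Wang–Xie arXiv:2312.10382, arXiv:2406.09856 (layer domains, Navier BC, axisymmetric);
  Tsai arXiv:2005.09691; Chae–Wolf arXiv:1604.07643; Seregin arXiv:1611.01563; Kozono–Terasawa–
  Wakasugi arXiv:2208.03850 — all need decay / integrability / symmetry absent here (as already
  recorded by rattack-17918).  Search this cycle: `lit search --source arxiv` ×6 (searchd local
  index down, OpenAlex/S2 HTTP 429 — degraded; recorded in NOTES).
* Barrier catalogue `Literature/Barriers/AnomalousDissipation/`: DeRosaDrivasInversi2024 (met at
  equality by design), DeRosaInversi2024 (BV — evaded, `|∇V| ~ 1/z`), AlexakisDoering2006 (2-D —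
  the object is 3-D only), Marchioro1986, Cheskidov2023, BrueDeLellis2023: none bites the crux as an
  implication; `ledger negatives --problem AnomalousDissipation`: no entry on this statement shape.
-/

end Summit.AnomalousDissipation.AnomalousDissipation.Cruxes.DyadicRealisation.Disproof
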